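/-
Copyright: the b2b-balaban cell (near-miss cell 7), T⁴-continuum fan-out, NE7b ROUND-2 swarm `t4-ne7b-formalise-*`
(seat leaf-01), row S6 «H2d zones» of lineage t4-ne7b-p1's claim table `LEAVES-NE7b.md`, part 2.
Released under the licence of the surrounding project.
-/
import Summits.QuantumFields.BalabanUV.T4Continuum.Support.HistoryZones
import Summits.QuantumFields.BalabanUV.T4Continuum.Support.HistoryChain

/-!
# History zones, part 2: zones of TAGGED genealogies and of binary-merger chains

Summits-side support leaf of the T⁴-continuum cell (rung (B)+1 on a FINITE torus only; NOT infinite volume, NOT the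
mass gap, NOT the Clay statement; NOT a proof of the spine estimate NE7b).  NE7b ROUND-2 swarm, row S6 (H2d) of
`t4/b2b-balaban-t4-ne7b-p1/LEAVES-NE7b.md`, second file (first: `Support/HistoryZones`, the zone map `regZone` read off
birth regions and `zoneReading_of_birthRegions`).  [folklore] finite bookkeeping over the lineage's OWN carriers;
nothing is quoted from print, nothing printed is asserted, no `[cite:]` tag, no `Prop` fact minted (`MergeNodes` is a
parametrised predicate — «every merger sub-node satisfies `ok`» — never asserted).

WHY.  Row S3 (`Support/HistoryChain`, `HistoryGen`) builds the live genealogy of a component TAGGED —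
`genT X : Gen (PEv × τ)`, each birth label carrying the record of its region — and hands the socket the FLAT genealogy
`gen X = ZoneSkeleton.gmap Prod.fst (genT X)`, a merger of several parts at one step being the binary-merger chain
`HistoryGen.chainMerge`.  Row S6 must read `ZoneReading` on the FLAT genealogy.  This file supplies the three transfer
facts that do not depend on rows S1∕S3's remaining definitions:
* §1 **`flatReg G' regT`** — the flat birth-region map of a tagged genealogy: the flat birth `b` gets the UNION of the
  recorded regions `regT ℓ` of the tagged births `ℓ` of `G'` with `ℓ.1 = b` (choice-free; ONE region under label
  genericity `Set.InjOn Prod.fst`, `flatReg_eq_of_injOn`); **`regZoneT`** — the zone map at the tagged level — and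
  **`regZoneT_subset_regZone_gmap`**: the tagged zone of a tagged sub-structure lies inside the flat zone of its image
  (so CONTACT transfers from tagged to flat with no genericity).
* §2 sub-structures of an image are images of sub-structures (`exists_sub_of_sub_gmap`); inversion of `Sub` at a
  merger (`sub_merge_inv`).
* §3 **`MergeNodes ok G`** («every merger sub-node `merge X Y e` of `G` satisfies `ok X Y e`») and
  **`mergeNodes_chainMerge`**: a chain's merger nodes are the members' nodes plus the `k` chain nodes
  «prefix `chainMerge G (Hs.take i) t` absorbs `Hs[i]` by the event `t i`»; **`mem_regZoneT_chainMerge`**: the zone of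
  a chain is the union of the members' zones — so the contact law along a chain is «each part meets the union of the
  earlier parts» (the CONTACT ORDER row S1 records, `NEEDS-S6.md` R2′).
* §4 **`birthRegions_gmap_of_tagged`**: range + diameter laws on the tagged births (diameter under label genericity) +
  the TAGGED contact law ⇒ `HistoryZones.BirthRegions n L K Cb (gmap Prod.fst G') (flatReg G' regT)`; with
  `HistoryZones.zoneReading_of_birthRegions` this is `ZoneReading` of the flat genealogy (`zoneReading_gmap_of_tagged`).
* §5 sanity, decided.

NOT DONE HERE (part 3, `HistoryZonesLive.lean`, after rows S1∕S3 land `AdmissibleHistory`∕`HistoryGen.genT`): the tagged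
contact law for `genT X` from S1's contact-order clause by `mergeNodes_chainMerge` along `HistoryGen.genT_eq`, and
`zoneReading_liveGen`.  Walls unchanged: (ID) G-ne7bp1g9-1 (H3, displayed), (E2)∕(R1) G-ne7bp1-1.  NE7b discharge: no date.

HONEST DEPENDENCY (cell): continuum YM on T⁴ ⇐ BetaPertH ∧ nine spine estimates (0/9 proved); BetaPertH ⇐ (D1) ∧ (D4)
∧ CAP+tail; G-an2-4 gates asym, D1 and NE2/3/4.  This file changes none of it.
-/

open Finset
open Literature.MathematicalPhysics.QuantumFieldTheory.Balaban1983to89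
open T4PersistenceDictionary T4PartnerMultiplicity
open Summit.QuantumFields.BalabanUV.T4Continuum.PlacementSkeleton
open Summit.QuantumFields.BalabanUV.T4Continuum.ZoneSkeleton
open Summit.QuantumFields.BalabanUV.T4Continuum.ZoneCrowd
open Summit.QuantumFields.BalabanUV.T4Continuum.ZoneTorus
open Summit.QuantumFields.BalabanUV.T4Continuum.HistoryZones
open Summit.QuantumFields.BalabanUV.T4Continuum.HistoryGen

namespace Summit.QuantumFields.BalabanUV.T4Continuum.HistoryZones

noncomputable section

variable {d : ℕ} {τ : Type*} [DecidableEq τ]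

/-! ## §1 The flat birth-region map of a tagged genealogy; tagged zones lie inside flat zones -/

/-- **THE FLAT BIRTH-REGION MAP** of a tagged genealogy `G'` with region record `regT`: the flat birth event `b` gets the
union of the regions of the tagged births of `G'` whose flat part is `b` (one region under label genericity).
[folklore] -/
def flatReg (G' : Gen (PEv × τ)) (regT : PEv × τ → Finset (Fin d → ℕ)) (b : PEv) : Finset (Fin d → ℕ) :=
  ((births G').filter fun ℓ => ℓ.1 = b).biUnion regT

/-- a tagged birth's region lies in the flat region of its flat part [folklore] -/
theorem subset_flatReg {G' : Gen (PEv × τ)} (regT : PEv × τ → Finset (Fin d → ℕ)) {ℓ : PEv × τ}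
    (hℓ : ℓ ∈ births G') : regT ℓ ⊆ flatReg G' regT ℓ.1 :=
  subset_biUnion_of_mem regT (mem_filter.2 ⟨hℓ, rfl⟩)

/-- membership in the flat region [folklore] -/
theorem mem_flatReg {G' : Gen (PEv × τ)} {regT : PEv × τ → Finset (Fin d → ℕ)} {b : PEv} {u : Fin d → ℕ} :
    u ∈ flatReg G' regT b ↔ ∃ ℓ ∈ births G', ℓ.1 = b ∧ u ∈ regT ℓ := by
  simp only [flatReg, mem_biUnion, mem_filter, and_assoc]

/-- **UNDER LABEL GENERICITY THE FLAT REGION IS THE ONE RECORDED REGION.** [folklore] -/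
theorem flatReg_eq_of_injOn {G' : Gen (PEv × τ)} (hinj : Set.InjOn Prod.fst (births G' : Set (PEv × τ)))
    (regT : PEv × τ → Finset (Fin d → ℕ)) {ℓ : PEv × τ} (hℓ : ℓ ∈ births G') : flatReg G' regT ℓ.1 = regT ℓ := by
  refine Subset.antisymm (fun u hu => ?_) (subset_flatReg regT hℓ)
  obtain ⟨ℓ', hℓ', h1, hu⟩ := mem_flatReg.1 hu
  rwa [hinj hℓ' hℓ h1] at hu

/-- **THE ZONE MAP AT THE TAGGED LEVEL**: as `HistoryZones.regZone`, over tagged births and their recorded regions.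
[folklore] -/
def regZoneT (L : ℕ) (regT : PEv × τ → Finset (Fin d → ℕ)) (t : ℕ) (X' : Gen (PEv × τ)) : Finset (Fin d → ℕ) :=
  (births X').biUnion fun ℓ => if ℓ.1.step ≤ t then (blocks L)^[t - ℓ.1.step] (regT ℓ) else ∅

/-- membership in the tagged zone [folklore] -/
theorem mem_regZoneT {L : ℕ} {regT : PEv × τ → Finset (Fin d → ℕ)} {t : ℕ} {X' : Gen (PEv × τ)} {u : Fin d → ℕ} :
    u ∈ regZoneT L regT t X' ↔ ∃ ℓ ∈ births X', ℓ.1.step ≤ t ∧ u ∈ (blocks L)^[t - ℓ.1.step] (regT ℓ) := by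
  rw [regZoneT, mem_biUnion]
  refine exists_congr fun ℓ => and_congr_right fun _ => ?_
  split_ifs with h <;> simp [h]

/-- a merger's tagged zone is the union of the partners' [folklore] -/
theorem regZoneT_merge (L : ℕ) (regT : PEv × τ → Finset (Fin d → ℕ)) (t : ℕ) (X' Y' : Gen (PEv × τ))
    (ℓ : PEv × τ) : regZoneT L regT t (Gen.merge X' Y' ℓ) = regZoneT L regT t X' ∪ regZoneT L regT t Y' := by
  simp only [regZoneT, births_merge, union_biUnion]

/-- blocking is monotone (iterated) [folklore] -/
theorem iterate_blocks_mono (L : ℕ) :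
    ∀ (k : ℕ) {S T : Finset (Fin d → ℕ)}, S ⊆ T → (blocks L)^[k] S ⊆ (blocks L)^[k] T
  | 0, _, _, h => h
  | k + 1, S, T, h => by
      rw [Function.iterate_succ_apply', Function.iterate_succ_apply']
      exact image_subset_image (iterate_blocks_mono L k h)

/-- **THE TAGGED ZONE OF A TAGGED SUB-STRUCTURE LIES IN THE FLAT ZONE OF ITS IMAGE** (flat regions read off the whole
`G'` by `flatReg`; no genericity needed). [folklore] -/
theorem regZoneT_subset_regZone_gmap {L : ℕ} {G' X' : Gen (PEv × τ)} (hs : Sub X' G')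
    (regT : PEv × τ → Finset (Fin d → ℕ)) (t : ℕ) :
    regZoneT L regT t X' ⊆ regZone L (flatReg G' regT) t (gmap Prod.fst X') := by
  intro u hu
  obtain ⟨ℓ, hℓ, hle, hu⟩ := mem_regZoneT.1 hu
  refine mem_regZone.2 ⟨ℓ.1, by rw [births_gmap]; exact mem_image_of_mem _ hℓ, hle, ?_⟩
  exact iterate_blocks_mono L _ (subset_flatReg regT (births_subset_of_sub' hs hℓ)) hu
where
  /-- births along `Sub`, tagged alphabet -/
  births_subset_of_sub' : ∀ {X G : Gen (PEv × τ)}, Sub X G → ∀ {ℓ}, ℓ ∈ births X → ℓ ∈ births G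
  | _, _, Sub.refl _, _, h => h
  | _, _, Sub.renew _ _ hs, _, h => by rw [births_renew]; exact births_subset_of_sub' hs h
  | _, _, Sub.left B _ hs, _, h => by rw [births_merge]; exact mem_union_left _ (births_subset_of_sub' hs h)
  | _, _, Sub.right A _ hs, _, h => by rw [births_merge]; exact mem_union_right _ (births_subset_of_sub' hs h)

/-! ## §2 Sub-structures of an image; inversion at a merger -/

omit [DecidableEq τ] in
/-- **A SUB-STRUCTURE OF AN IMAGE IS THE IMAGE OF A SUB-STRUCTURE.** [folklore] -/
theorem exists_sub_of_sub_gmap {ε ε' : Type*} (f : ε → ε') :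
    ∀ {G : Gen ε} {Z : Gen ε'}, Sub Z (gmap f G) → ∃ Z₀, Sub Z₀ G ∧ gmap f Z₀ = Z
  | Gen.born b j, Z, h => by
      cases h
      exact ⟨_, Sub.refl _, rfl⟩
  | Gen.renew G e k, Z, h => by
      cases h with
      | refl => exact ⟨_, Sub.refl _, rfl⟩
      | renew _ _ hs =>
          obtain ⟨Z₀, h₀, rfl⟩ := exists_sub_of_sub_gmap f hs
          exact ⟨Z₀, Sub.renew e k h₀, rfl⟩
  | Gen.merge X Y e, Z, h => by
      cases h with
      | refl => exact ⟨_, Sub.refl _, rfl⟩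
      | left _ _ hs =>
          obtain ⟨Z₀, h₀, rfl⟩ := exists_sub_of_sub_gmap f hs
          exact ⟨Z₀, Sub.left Y e h₀, rfl⟩
      | right _ _ hs =>
          obtain ⟨Z₀, h₀, rfl⟩ := exists_sub_of_sub_gmap f hs
          exact ⟨Z₀, Sub.right X e h₀, rfl⟩

omit [DecidableEq τ] in
/-- inversion of `Sub` at a merger: the whole, or inside a partner [folklore] -/
theorem sub_merge_inv {ε : Type*} {Z X Y : Gen ε} {e : ε} (h : Sub Z (Gen.merge X Y e)) :
    Z = Gen.merge X Y e ∨ Sub Z X ∨ Sub Z Y := by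
  cases h with
  | refl => exact Or.inl rfl
  | left _ _ hs => exact Or.inr (Or.inl hs)
  | right _ _ hs => exact Or.inr (Or.inr hs)

omit [DecidableEq τ] in
/-- inversion of `Sub` at a renewal [folklore] -/
theorem sub_renew_inv {ε : Type*} {Z X : Gen ε} {e : ε} {k : ℕ} (h : Sub Z (Gen.renew X e k)) :
    Z = Gen.renew X e k ∨ Sub Z X := by
  cases h with
  | refl => exact Or.inl rfl
  | renew _ _ hs => exact Or.inr hs

omit [DecidableEq τ] in
/-- inversion of `Sub` at a bare birth [folklore] -/
theorem sub_born_inv {ε : Type*} {Z : Gen ε} {b : ε} {j : ℕ} (h : Sub Z (Gen.born b j)) : Z = Gen.born b j := by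
  cases h; rfl

/-! ## §3 Merger nodes of a chain; the zone of a chain -/

section Chain

variable {ε : Type*}

/-- `MergeNodes ok G`: every merger sub-node `merge X Y e` of `G` satisfies `ok X Y e`. [folklore] -/
def MergeNodes (ok : Gen ε → Gen ε → ε → Prop) (G : Gen ε) : Prop :=
  ∀ (X Y : Gen ε) (e : ε), Sub (Gen.merge X Y e) G → ok X Y e

/-- a bare birth has no merger node [folklore] -/
theorem mergeNodes_born (ok : Gen ε → Gen ε → ε → Prop) (b : ε) (j : ℕ) : MergeNodes ok (Gen.born b j) :=
  fun _ _ _ h => by cases h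

/-- the merger nodes of a renewal are those of the renewed structure [folklore] -/
theorem mergeNodes_renew_iff (ok : Gen ε → Gen ε → ε → Prop) (X : Gen ε) (e : ε) (k : ℕ) :
    MergeNodes ok (Gen.renew X e k) ↔ MergeNodes ok X := by
  refine ⟨fun h A B e' hs => h A B e' (Sub.renew e k hs), fun h A B e' hs => ?_⟩
  rcases sub_renew_inv hs with h' | h'
  · cases h'
  · exact h A B e' h'

/-- the merger nodes of a merger: the partners' nodes and the top node [folklore] -/
theorem mergeNodes_merge_iff (ok : Gen ε → Gen ε → ε → Prop) (X Y : Gen ε) (e : ε) :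
    MergeNodes ok (Gen.merge X Y e) ↔ MergeNodes ok X ∧ MergeNodes ok Y ∧ ok X Y e := by
  refine ⟨fun h => ⟨fun A B e' hs => h A B e' (Sub.left Y e hs), fun A B e' hs => h A B e' (Sub.right X e hs),
    h X Y e (Sub.refl _)⟩, fun h A B e' hs => ?_⟩
  rcases sub_merge_inv hs with h' | h' | h'
  · cases h'; exact h.2.2
  · exact h.1 A B e' h'
  · exact h.2.1 A B e' h'

/-- **THE MERGER NODES OF A CHAIN**: the head's and the members' nodes, plus the chain nodes «the prefix
`chainMerge G (Hs.take i) t` absorbs `Hs[i]` by the event `t i`». [folklore] -/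
theorem mergeNodes_chainMerge (ok : Gen ε → Gen ε → ε → Prop) :
    ∀ {G : Gen ε} {Hs : List (Gen ε)} {t : ℕ → ε}, MergeNodes ok G → (∀ H ∈ Hs, MergeNodes ok H) →
      (∀ (i : ℕ) (hi : i < Hs.length), ok (chainMerge G (Hs.take i) t) (Hs[i]) (t i)) →
      MergeNodes ok (chainMerge G Hs t)
  | _, [], _, hG, _, _ => hG
  | G, H :: Hs, t, hG, hHs, hch => by
      rw [chainMerge_cons]
      refine mergeNodes_chainMerge ok ?_ (fun H' hH' => hHs H' (List.mem_cons_of_mem _ hH')) fun i hi => ?_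
      · exact (mergeNodes_merge_iff ok G H (t 0)).2 ⟨hG, hHs H List.mem_cons_self, hch 0 (by simp)⟩
      · exact hch (i + 1) (by simpa using hi)

variable [DecidableEq ε]

/-- births of a chain: the head's or a member's [folklore] -/
theorem mem_births_chainMerge {b : ε} :
    ∀ {G : Gen ε} {Hs : List (Gen ε)} {t : ℕ → ε},
      b ∈ births (chainMerge G Hs t) ↔ b ∈ births G ∨ ∃ H ∈ Hs, b ∈ births H
  | _, [], _ => by simp
  | G, H :: Hs, t => by
      rw [chainMerge_cons, mem_births_chainMerge, births_merge, mem_union]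
      constructor
      · rintro ((h | h) | ⟨H', hH', h⟩)
        · exact Or.inl h
        · exact Or.inr ⟨H, List.mem_cons_self, h⟩
        · exact Or.inr ⟨H', List.mem_cons_of_mem _ hH', h⟩
      · rintro (h | ⟨H', hH', h⟩)
        · exact Or.inl (Or.inl h)
        · rcases List.mem_cons.1 hH' with rfl | hH'
          · exact Or.inl (Or.inr h)
          · exact Or.inr ⟨H', hH', h⟩

end Chain

/-- **THE ZONE OF A CHAIN IS THE UNION OF THE MEMBERS' ZONES** (tagged level). [folklore] -/
theorem mem_regZoneT_chainMerge {L : ℕ} {regT : PEv × τ → Finset (Fin d → ℕ)} {t : ℕ} {u : Fin d → ℕ}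
    {G : Gen (PEv × τ)} {Hs : List (Gen (PEv × τ))} {tg : ℕ → PEv × τ} :
    u ∈ regZoneT L regT t (chainMerge G Hs tg) ↔ u ∈ regZoneT L regT t G ∨ ∃ H ∈ Hs, u ∈ regZoneT L regT t H := by
  simp only [mem_regZoneT, mem_births_chainMerge]
  constructor
  · rintro ⟨ℓ, hℓ | ⟨H, hH, hℓ⟩, hle, hu⟩
    · exact Or.inl ⟨ℓ, hℓ, hle, hu⟩
    · exact Or.inr ⟨H, hH, ℓ, hℓ, hle, hu⟩
  · rintro (⟨ℓ, hℓ, hle, hu⟩ | ⟨H, hH, ℓ, hℓ, hle, hu⟩)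
    · exact ⟨ℓ, Or.inl hℓ, hle, hu⟩
    · exact ⟨ℓ, Or.inr ⟨H, hH, hℓ⟩, hle, hu⟩

/-- the same at the flat level (`HistoryZones.regZone`) [folklore] -/
theorem mem_regZone_chainMerge {L : ℕ} {reg : PEv → Finset (Fin d → ℕ)} {t : ℕ} {u : Fin d → ℕ}
    {G : Gen PEv} {Hs : List (Gen PEv)} {tg : ℕ → PEv} :
    u ∈ regZone L reg t (chainMerge G Hs tg) ↔ u ∈ regZone L reg t G ∨ ∃ H ∈ Hs, u ∈ regZone L reg t H := by
  simp only [mem_regZone, mem_births_chainMerge]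
  constructor
  · rintro ⟨b, hb | ⟨H, hH, hb⟩, hle, hu⟩
    · exact Or.inl ⟨b, hb, hle, hu⟩
    · exact Or.inr ⟨H, hH, b, hb, hle, hu⟩
  · rintro (⟨b, hb, hle, hu⟩ | ⟨H, hH, b, hb, hle, hu⟩)
    · exact ⟨b, Or.inl hb, hle, hu⟩
    · exact ⟨b, Or.inr ⟨H, hH, hb⟩, hle, hu⟩

/-! ## §4 The birth-region laws of the flat genealogy from tagged data -/

/-- **`BirthRegions` OF THE FLAT GENEALOGY FROM TAGGED DATA.**  For a tagged genealogy `G'` with region record `regT`: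
if every tagged birth's region is in range of its level, the birth labels are generic (`Set.InjOn Prod.fst` on the
births) with each region of diameter `≤ Cb·wtPEv ℓ.1`, and at every tagged merger sub-node the partners' TAGGED zones
share a block, then the flat genealogy `gmap Prod.fst G'` with the flat region map `flatReg G' regT` obeys
`HistoryZones.BirthRegions n L K Cb`. [folklore] -/
theorem birthRegions_gmap_of_tagged {n L K : ℕ} {Cb : ℝ} {G' : Gen (PEv × τ)} {regT : PEv × τ → Finset (Fin d → ℕ)}
    (hR : ∀ ℓ ∈ births G', InRange (n * L ^ (K - ℓ.1.step)) (regT ℓ))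
    (hinj : Set.InjOn Prod.fst (births G' : Set (PEv × τ)))
    (hD : ∀ ℓ ∈ births G', (diam (n * L ^ (K - ℓ.1.step)) (regT ℓ) : ℝ) ≤ Cb * wtPEv ℓ.1)
    (hC : MergeNodes (fun X' Y' ℓ => ∃ z, z ∈ regZoneT L regT ℓ.1.step X' ∧ z ∈ regZoneT L regT ℓ.1.step Y') G') :
    BirthRegions n L K Cb (gmap Prod.fst G') (flatReg G' regT) where
  inRange b hb u hu i := by
    obtain ⟨ℓ, hℓ, hb1, huℓ⟩ := mem_flatReg.1 hu
    subst hb1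
    exact hR ℓ hℓ u huℓ i
  diam_le b hb := by
    rw [births_gmap] at hb
    obtain ⟨ℓ, hℓ, rfl⟩ := mem_image.1 hb
    rw [flatReg_eq_of_injOn hinj regT hℓ]
    exact hD ℓ hℓ
  contact X Y e hs := by
    obtain ⟨Z₀, h₀, hZ⟩ := exists_sub_of_sub_gmap Prod.fst hs
    match Z₀, h₀, hZ with
    | Gen.merge X' Y' ℓ, h₀, hZ =>
        simp only [gmap, Gen.merge.injEq] at hZ
        obtain ⟨rfl, rfl, rfl⟩ := hZ
        obtain ⟨z, hzX, hzY⟩ := hC X' Y' ℓ h₀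
        exact ⟨z, regZoneT_subset_regZone_gmap (Sub.trans (Sub.left Y' ℓ (Sub.refl X')) h₀) regT _ hzX,
          regZoneT_subset_regZone_gmap (Sub.trans (Sub.right X' ℓ (Sub.refl Y')) h₀) regT _ hzY⟩
    | Gen.born _ _, _, hZ => simp [gmap] at hZ
    | Gen.renew _ _ _, _, hZ => simp [gmap] at hZ

/-- **… HENCE THE ZONE READING OF THE FLAT GENEALOGY** (with `HistoryZones.zoneReading_of_birthRegions`; chronology of
the flat genealogy is row S5's `HistoryGen.chrono_gen`). [folklore] -/
theorem zoneReading_gmap_of_tagged {n L K : ℕ} (hL : 1 ≤ L) {Cb : ℝ} {G' : Gen (PEv × τ)}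
    (hchr : Chrono PEv.step (gmap Prod.fst G')) {regT : PEv × τ → Finset (Fin d → ℕ)}
    (hR : ∀ ℓ ∈ births G', InRange (n * L ^ (K - ℓ.1.step)) (regT ℓ))
    (hinj : Set.InjOn Prod.fst (births G' : Set (PEv × τ)))
    (hD : ∀ ℓ ∈ births G', (diam (n * L ^ (K - ℓ.1.step)) (regT ℓ) : ℝ) ≤ Cb * wtPEv ℓ.1)
    (hC : MergeNodes (fun X' Y' ℓ => ∃ z, z ∈ regZoneT L regT ℓ.1.step X' ∧ z ∈ regZoneT L regT ℓ.1.step Y') G') :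
    ZoneReading n L K Cb (gmap Prod.fst G') (regZone L (flatReg G' regT)) :=
  zoneReading_of_birthRegions hL hchr (birthRegions_gmap_of_tagged hR hinj hD hC)

/-! ## §5 Sanity (decided) -/

namespace Sanity

/-- tags: plain indices -/
def regT₂ : PEv × ℕ → Finset (Fin 1 → ℕ) := fun ℓ =>
  if ℓ = ((0, 0, 1), 7) then {![4], ![5]} else if ℓ = ((1, 0, 0), 8) then {![2]} else ∅

/-- a tagged chain: the old region (tag 7) absorbs the new one (tag 8) at step 1 by the merger tagged 9 -/
def GT₂ : Gen (PEv × ℕ) := chainMerge (Gen.born ((0, 0, 1), 7) 0) [Gen.born ((1, 0, 0), 8) 1] fun _ => ((1, 2, 0), 9)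

/-- the flat region of the flat birth `(0,0,1)` is the recorded one -/
example : flatReg GT₂ regT₂ (0, 0, 1) = {![4], ![5]} := by decide

/-- the tagged zone of the chain at step 1: `blocks 2 {4,5} ∪ {2} = {2}` -/
example : regZoneT 2 regT₂ 1 GT₂ = {![2]} := by decide

end Sanity

end

end Summit.QuantumFields.BalabanUV.T4Continuum.HistoryZones
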